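import Mathlib
import Summits.QuantumFields.QCD.Theorems.PauliWegnerSeaTiltedFlatness
import Literature.MathematicalPhysics.QuantumFieldTheory.QCDPhaseQuenched

/-!
# Stub `stub_twoStarFlatnessPackage` of line `crossing-split-integrability`
(crux `Summit.QuantumFields.QCD.Theses.PauliWegnerSea.PhaseQuenchedFlavourDecay`, item stmt-QuantumFields-9151)

The two-star flatness package used by the fibre moment reduction of the minor-form core: on every
two-star fibre (links of `star(x) ∪ star(y)` free, the rest frozen to `U`; `L ≥ 4`, `0 ≤ β ≤ βmax`,
masses in `[-2,2]^{N_f}`), with `wt = e^{-β·wilsonAction ∘ refit}`, product Haar and `Z = ∫ wt`,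

1. the one-flavour sea `Ff = |det D_W(refit ·, m_f)|` is flat: `Ff(W₀) · Z ≤ C ∫ Ff wt`;
2. the sea of the other flavours `G = ∏_{g ≠ f} |det D_W(refit ·, m_g)|` is flat: `G(W₀) · Z ≤ C ∫ G wt`;
3. relative small balls for `Ff`: if `∫ Ff wt > 0` then
   `∫ 1{Ff · Z ≤ η ∫ Ff wt} wt ≤ C η^c Z` for every `η > 0`.

Proof: the PROVED crux `TiltedFlatness` (stmt-QuantumFields-14070,
`Summit.QuantumFields.QCD.Theorems.CircleTransport.TiltedFlatness_proof`) applied twice — with ONE flavour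
of mass `m_f` (`|det diracMatrix| = Ff`, by `norm_det_diracMatrix` and `Fin.prod_univ_one`; clauses 1 and 3)
and, for `N_f = n + 1`, with the `n` other flavours `mq ∘ f.succAbove` (`|det diracMatrix| = G`, by
`norm_det_diracMatrix` and the bijection `f.succAbove : Fin n → {f}ᶜ`; clause 2).  The polynomial factors
`(1+β)^p ≤ (1+βmax)^{max p 0}` are absorbed into `C`; `Z > 0` (continuous positive weight on a compact
probability space) converts the relative statements (`M = ∫ F wt / Z`) into the cleared-denominator form.
-/

noncomputable section

namespace Summit.QuantumFields.QCD.Cruxes.PhaseQuenchedFlavourDecay.CrossingSplitIntegrability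

open scoped BigOperators
open MeasureTheory Filter
open Literature.MathematicalPhysics.QuantumFieldTheory Literature.MathematicalPhysics.QuantumLattice
  Literature.Probability.LatticeModels

/-- Registered stub `stub_twoStarFlatnessPackage` of line `crossing-split-integrability` for crux
stmt-QuantumFields-9151: the two-star flatness package (flatness of the one-flavour sea `Ff`, flatness of
the complementary sea `G`, relative small balls for `Ff`), with constants depending on `N_f` and `βmax`
only — a repackaging of the proved crux `TiltedFlatness` (stmt-QuantumFields-14070) applied to one flavour
and to the other `N_f - 1` flavours. -/
theorem twoStarFlatnessPackage :
    ∀ (Nf : ℕ) (βmax : ℝ), 0 ≤ βmax → ∃ C c : ℝ, 0 < C ∧ 0 < c ∧ ∀ β : ℝ, 0 ≤ β → β ≤ βmax →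
      ∀ mq : Fin Nf → ℝ, (∀ f, -2 ≤ mq f ∧ mq f ≤ 2) → ∀ (L : ℕ) [NeZero L], 4 ≤ L →
      ∀ (U : GaugeConfig 4 L (Matrix.specialUnitaryGroup (Fin 3) ℂ)) (x y : TorusSite 4 L) (f : Fin Nf),
      let star : Edge 4 L → Prop := fun e => e.1 = x ∨ Site.shift e.1 e.2 = x ∨ e.1 = y ∨ Site.shift e.1 e.2 = y;
      let refit : GaugeConfig 4 L (Matrix.specialUnitaryGroup (Fin 3) ℂ) →
          GaugeConfig 4 L (Matrix.specialUnitaryGroup (Fin 3) ℂ) := fun W e => if star e then W e else U e;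
      let Ff : GaugeConfig 4 L (Matrix.specialUnitaryGroup (Fin 3) ℂ) → ℝ :=
        fun W => ‖fermionDet (wilsonDirac (fundamentalRep (Fin 3)) (refit W) (mq f) 1)‖;
      let G : GaugeConfig 4 L (Matrix.specialUnitaryGroup (Fin 3) ℂ) → ℝ := fun W =>
        ∏ g ∈ Finset.univ.erase f, ‖fermionDet (wilsonDirac (fundamentalRep (Fin 3)) (refit W) (mq g) 1)‖;
      let wt : GaugeConfig 4 L (Matrix.specialUnitaryGroup (Fin 3) ℂ) → ℝ :=
        fun W => Real.exp (-(β * wilsonAction (fundamentalRep (Fin 3)) (refit W)));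
      let haar : Measure (GaugeConfig 4 L (Matrix.specialUnitaryGroup (Fin 3) ℂ)) :=
        Measure.pi fun _ => haarProbability (Matrix.specialUnitaryGroup (Fin 3) ℂ);
      (∀ W₀ : GaugeConfig 4 L (Matrix.specialUnitaryGroup (Fin 3) ℂ),
          Ff W₀ * ∫ W, wt W ∂haar ≤ C * ∫ W, Ff W * wt W ∂haar) ∧
      (∀ W₀ : GaugeConfig 4 L (Matrix.specialUnitaryGroup (Fin 3) ℂ),
          G W₀ * ∫ W, wt W ∂haar ≤ C * ∫ W, G W * wt W ∂haar) ∧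
      (0 < ∫ W, Ff W * wt W ∂haar → ∀ η : ℝ, 0 < η →
        ∫ W, (if Ff W * ∫ W', wt W' ∂haar ≤ η * ∫ W', Ff W' * wt W' ∂haar then (1 : ℝ) else 0) * wt W ∂haar ≤
          C * η ^ c * ∫ W', wt W' ∂haar) := by
  intro Nf βmax hβmax
  obtain _ | n := Nf
  · refine ⟨1, 1, one_pos, one_pos, ?_⟩
    intro β _ _ mq _ L _ _ U x y f
    exact f.elim0
  obtain ⟨C₁, p₁, c₁, hC₁, hc₁, h₁⟩ := Summit.QuantumFields.QCD.Theorems.CircleTransport.TiltedFlatness_proof 1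
  obtain ⟨C₂, p₂, c₂, hC₂, -, h₂⟩ := Summit.QuantumFields.QCD.Theorems.CircleTransport.TiltedFlatness_proof n
  set K₁ : ℝ := C₁ * (1 + βmax) ^ (max p₁ 0) with hK₁
  set K₂ : ℝ := C₂ * (1 + βmax) ^ (max p₂ 0) with hK₂
  have hK₁pos : 0 < K₁ := mul_pos hC₁ (Real.rpow_pos_of_pos (by linarith) _)
  refine ⟨max K₁ K₂, c₁, lt_max_of_lt_left hK₁pos, hc₁, ?_⟩
  intro β hβ hββ mq hmq L _ hL U x y f star refit Ff G wt haar
  -- the polynomial factors `(1+β)^p` are absorbed into the constant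
  have h1β : (1 : ℝ) ≤ 1 + β := by linarith
  have hpow : ∀ p : ℝ, (1 + β) ^ p ≤ (1 + βmax) ^ (max p 0) := fun p =>
    (Real.rpow_le_rpow_of_exponent_le h1β (le_max_left p 0)).trans
      (Real.rpow_le_rpow (by linarith) (by linarith) (le_max_right p 0))
  have hCK₁ : C₁ * (1 + β) ^ p₁ ≤ max K₁ K₂ :=
    (mul_le_mul_of_nonneg_left (hpow p₁) hC₁.le).trans (le_max_left _ _)
  have hCK₂ : C₂ * (1 + β) ^ p₂ ≤ max K₁ K₂ :=
    (mul_le_mul_of_nonneg_left (hpow p₂) hC₂.le).trans (le_max_right _ _)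
  -- positivity of the partition function `Z`
  have hrefit : Continuous refit := by
    refine continuous_pi fun e => ?_
    by_cases h : star e
    · simp only [refit, if_pos h]; exact continuous_apply e
    · simp only [refit, if_neg h]; exact continuous_const
  have hSc : Continuous fun W => wilsonAction (fundamentalRep (Fin 3)) (refit W) :=
    (Summit.QuantumFields.QCD.Theorems.TiltedFlatnessNegative.continuous_wilsonAction
      (fundamentalRep (Fin 3)) (continuous_fundamentalRep (Fin 3))).comp hrefit
  have hwtc : Continuous wt := Real.continuous_exp.comp ((continuous_const.mul hSc).neg)
  have hwt0 : ∀ W, 0 < wt W := fun W => Real.exp_pos _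
  have hF0 : ∀ W, 0 ≤ Ff W := fun W => norm_nonneg _
  have hG0 : ∀ W, 0 ≤ G W := fun W => Finset.prod_nonneg fun _ _ => norm_nonneg _
  haveI : IsProbabilityMeasure haar := by
    show IsProbabilityMeasure
      (Measure.pi fun _ => haarProbability (Matrix.specialUnitaryGroup (Fin 3) ℂ))
    infer_instance
  set Z : ℝ := ∫ W, wt W ∂haar with hZdef
  set I₁ : ℝ := ∫ W, Ff W * wt W ∂haar with hI₁def
  set I₂ : ℝ := ∫ W, G W * wt W ∂haar with hI₂def
  have hZ : 0 < Z := by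
    obtain ⟨Wm, -, hWm⟩ := isCompact_univ.exists_isMinOn Set.univ_nonempty hwtc.continuousOn
    have hle : ∫ _W, wt Wm ∂haar ≤ Z :=
      integral_mono (integrable_const _)
        (Summit.QuantumFields.QCD.Theorems.TiltedFlatnessNegative.integrable_of_continuous hwtc)
        fun W => hWm (Set.mem_univ W)
    have hc' : ∫ _W, wt Wm ∂haar = wt Wm := by simp
    linarith [hwt0 Wm]
  have hI₁0 : 0 ≤ I₁ := integral_nonneg fun W => mul_nonneg (hF0 W) (hwt0 W).le
  have hI₂0 : 0 ≤ I₂ := integral_nonneg fun W => mul_nonneg (hG0 W) (hwt0 W).le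
  -- the two instances of `TiltedFlatness`: one flavour of mass `mq f`, and the `n` other flavours
  set mq₁ : Fin 1 → ℝ := fun _ => mq f with hmq₁
  set mq₂ : Fin n → ℝ := fun i => mq (f.succAbove i) with hmq₂
  have key₁ : ∀ W, ‖(diracMatrix (refit W) mq₁).det‖ = Ff W := fun W => by
    rw [norm_det_diracMatrix, Fin.prod_univ_one]
  have key₂ : ∀ W, ‖(diracMatrix (refit W) mq₂).det‖ = G W := fun W => by
    rw [norm_det_diracMatrix]
    show ∏ i : Fin n, ‖fermionDet (wilsonDirac (fundamentalRep (Fin 3)) (refit W) (mq (f.succAbove i)) 1)‖ =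
      ∏ g ∈ Finset.univ.erase f, ‖fermionDet (wilsonDirac (fundamentalRep (Fin 3)) (refit W) (mq g) 1)‖
    rw [← Finset.compl_singleton, ← Fin.image_succAbove_univ,
      Finset.prod_image Fin.succAbove_right_injective.injOn]
  have hint₁ : ∫ W, ‖(diracMatrix (refit W) mq₁).det‖ * wt W ∂haar = I₁ := by
    simp_rw [key₁]; rfl
  have hint₂ : ∫ W, ‖(diracMatrix (refit W) mq₂).det‖ * wt W ∂haar = I₂ := by
    simp_rw [key₂]; rfl
  obtain ⟨hA₁', hB₁'⟩ := h₁ β hβ mq₁ (fun _ => hmq f) L hL U x y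
  obtain ⟨hA₂', -⟩ := h₂ β hβ mq₂ (fun i => hmq (f.succAbove i)) L hL U x y
  have hA₁ : ∀ W₀, Ff W₀ ≤ C₁ * (1 + β) ^ p₁ * (I₁ / Z) := by
    intro W₀
    have h : ‖(diracMatrix (refit W₀) mq₁).det‖ ≤
        C₁ * (1 + β) ^ p₁ * ((∫ W, ‖(diracMatrix (refit W) mq₁).det‖ * wt W ∂haar) / Z) := hA₁' W₀
    rwa [key₁, hint₁] at h
  have hA₂ : ∀ W₀, G W₀ ≤ C₂ * (1 + β) ^ p₂ * (I₂ / Z) := by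
    intro W₀
    have h : ‖(diracMatrix (refit W₀) mq₂).det‖ ≤
        C₂ * (1 + β) ^ p₂ * ((∫ W, ‖(diracMatrix (refit W) mq₂).det‖ * wt W ∂haar) / Z) := hA₂' W₀
    rwa [key₂, hint₂] at h
  have hB₁ : 0 < I₁ / Z → ∀ ε : ℝ, 0 < ε →
      (∫ W, (if Ff W ≤ ε * (I₁ / Z) then (1 : ℝ) else 0) * wt W ∂haar) / Z ≤
        C₁ * (1 + β) ^ p₁ * ε ^ c₁ := by
    intro hM ε hε
    have hM' : 0 < (∫ W, ‖(diracMatrix (refit W) mq₁).det‖ * wt W ∂haar) / Z := by rwa [hint₁]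
    have h : (∫ W, (if ‖(diracMatrix (refit W) mq₁).det‖ ≤
          ε * ((∫ W, ‖(diracMatrix (refit W) mq₁).det‖ * wt W ∂haar) / Z) then (1 : ℝ) else 0) *
            wt W ∂haar) / Z ≤ C₁ * (1 + β) ^ p₁ * ε ^ c₁ := hB₁' hM' ε hε
    rw [hint₁] at h
    simp only [key₁] at h
    exact h
  refine ⟨fun W₀ => ?_, fun W₀ => ?_, fun hpos η hη => ?_⟩
  · calc Ff W₀ * Z ≤ C₁ * (1 + β) ^ p₁ * (I₁ / Z) * Z := mul_le_mul_of_nonneg_right (hA₁ W₀) hZ.le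
      _ = C₁ * (1 + β) ^ p₁ * I₁ := by rw [mul_assoc, div_mul_cancel₀ _ hZ.ne']
      _ ≤ max K₁ K₂ * I₁ := mul_le_mul_of_nonneg_right hCK₁ hI₁0
  · calc G W₀ * Z ≤ C₂ * (1 + β) ^ p₂ * (I₂ / Z) * Z := mul_le_mul_of_nonneg_right (hA₂ W₀) hZ.le
      _ = C₂ * (1 + β) ^ p₂ * I₂ := by rw [mul_assoc, div_mul_cancel₀ _ hZ.ne']
      _ ≤ max K₁ K₂ * I₂ := mul_le_mul_of_nonneg_right hCK₂ hI₂0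
  · have hM : 0 < I₁ / Z := div_pos hpos hZ
    have hb := hB₁ hM η hη
    rw [div_le_iff₀ hZ] at hb
    have hev : ∀ W, (Ff W * Z ≤ η * I₁ ↔ Ff W ≤ η * (I₁ / Z)) := fun W => by
      rw [mul_div_assoc', le_div_iff₀ hZ]
    have hint : ∫ W, (if Ff W * Z ≤ η * I₁ then (1 : ℝ) else 0) * wt W ∂haar =
        ∫ W, (if Ff W ≤ η * (I₁ / Z) then (1 : ℝ) else 0) * wt W ∂haar := by
      congr 1
      funext W
      rw [if_congr (hev W) rfl rfl]
    calc ∫ W, (if Ff W * Z ≤ η * I₁ then (1 : ℝ) else 0) * wt W ∂haar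
        = ∫ W, (if Ff W ≤ η * (I₁ / Z) then (1 : ℝ) else 0) * wt W ∂haar := hint
      _ ≤ C₁ * (1 + β) ^ p₁ * η ^ c₁ * Z := hb
      _ ≤ max K₁ K₂ * η ^ c₁ * Z :=
          mul_le_mul_of_nonneg_right (mul_le_mul_of_nonneg_right hCK₁ (Real.rpow_nonneg hη.le c₁)) hZ.le

/-- Registered stub `stub_twoStarFlatnessPackage` (crux stmt-QuantumFields-9151, line `crossing-split-integrability`):
the LET-FREE spelling of `twoStarFlatnessPackage` (the gate's stub matcher cannot see past a `:=` inside a statement,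
so the registered signature inlines `star`, `refit`, `Ff`, `G`, `wt`, `haar`).  Definitionally the same proposition. -/
theorem stub_twoStarFlatnessPackage :
    ∀ (Nf : ℕ) (βmax : ℝ), 0 ≤ βmax → ∃ C c : ℝ, 0 < C ∧ 0 < c ∧ ∀ β : ℝ, 0 ≤ β → β ≤ βmax → ∀ mq : Fin Nf → ℝ, (∀
    f, -2 ≤ mq f ∧ mq f ≤ 2) → ∀ (L : ℕ) [NeZero L], 4 ≤ L → ∀ (U : GaugeConfig 4 L SU3) (x y : TorusSite 4 L) (f :
    Fin Nf), (∀ W₀ : GaugeConfig 4 L SU3, ‖fermionDet (wilsonDirac (fundamentalRep (Fin 3)) (fun e => if e.1 = x ∨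
    Site.shift e.1 e.2 = x ∨ e.1 = y ∨ Site.shift e.1 e.2 = y then W₀ e else U e) (mq f) 1)‖ * ∫ W, Real.exp (-(β *
    wilsonAction (fundamentalRep (Fin 3)) (fun e => if e.1 = x ∨ Site.shift e.1 e.2 = x ∨ e.1 = y ∨ Site.shift e.1
    e.2 = y then W e else U e))) ∂(Measure.pi fun _ : Edge 4 L => haarProbability SU3) ≤ C * ∫ W, ‖fermionDet
    (wilsonDirac (fundamentalRep (Fin 3)) (fun e => if e.1 = x ∨ Site.shift e.1 e.2 = x ∨ e.1 = y ∨ Site.shift e.1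
    e.2 = y then W e else U e) (mq f) 1)‖ * Real.exp (-(β * wilsonAction (fundamentalRep (Fin 3)) (fun e => if e.1 =
    x ∨ Site.shift e.1 e.2 = x ∨ e.1 = y ∨ Site.shift e.1 e.2 = y then W e else U e))) ∂(Measure.pi fun _ : Edge 4 L
    => haarProbability SU3)) ∧ (∀ W₀ : GaugeConfig 4 L SU3, (∏ g ∈ Finset.univ.erase f, ‖fermionDet (wilsonDirac
    (fundamentalRep (Fin 3)) (fun e => if e.1 = x ∨ Site.shift e.1 e.2 = x ∨ e.1 = y ∨ Site.shift e.1 e.2 = y then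
    W₀ e else U e) (mq g) 1)‖) * ∫ W, Real.exp (-(β * wilsonAction (fundamentalRep (Fin 3)) (fun e => if e.1 = x ∨
    Site.shift e.1 e.2 = x ∨ e.1 = y ∨ Site.shift e.1 e.2 = y then W e else U e))) ∂(Measure.pi fun _ : Edge 4 L =>
    haarProbability SU3) ≤ C * ∫ W, (∏ g ∈ Finset.univ.erase f, ‖fermionDet (wilsonDirac (fundamentalRep (Fin 3))
    (fun e => if e.1 = x ∨ Site.shift e.1 e.2 = x ∨ e.1 = y ∨ Site.shift e.1 e.2 = y then W e else U e) (mq g) 1)‖)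
    * Real.exp (-(β * wilsonAction (fundamentalRep (Fin 3)) (fun e => if e.1 = x ∨ Site.shift e.1 e.2 = x ∨ e.1 = y
    ∨ Site.shift e.1 e.2 = y then W e else U e))) ∂(Measure.pi fun _ : Edge 4 L => haarProbability SU3)) ∧ (0 < ∫ W,
    ‖fermionDet (wilsonDirac (fundamentalRep (Fin 3)) (fun e => if e.1 = x ∨ Site.shift e.1 e.2 = x ∨ e.1 = y ∨
    Site.shift e.1 e.2 = y then W e else U e) (mq f) 1)‖ * Real.exp (-(β * wilsonAction (fundamentalRep (Fin 3))
    (fun e => if e.1 = x ∨ Site.shift e.1 e.2 = x ∨ e.1 = y ∨ Site.shift e.1 e.2 = y then W e else U e)))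
    ∂(Measure.pi fun _ : Edge 4 L => haarProbability SU3) → ∀ η : ℝ, 0 < η → ∫ W, (if ‖fermionDet (wilsonDirac
    (fundamentalRep (Fin 3)) (fun e => if e.1 = x ∨ Site.shift e.1 e.2 = x ∨ e.1 = y ∨ Site.shift e.1 e.2 = y then W
    e else U e) (mq f) 1)‖ * ∫ W', Real.exp (-(β * wilsonAction (fundamentalRep (Fin 3)) (fun e => if e.1 = x ∨
    Site.shift e.1 e.2 = x ∨ e.1 = y ∨ Site.shift e.1 e.2 = y then W' e else U e))) ∂(Measure.pi fun _ : Edge 4 L =>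
    haarProbability SU3) ≤ η * ∫ W', ‖fermionDet (wilsonDirac (fundamentalRep (Fin 3)) (fun e => if e.1 = x ∨
    Site.shift e.1 e.2 = x ∨ e.1 = y ∨ Site.shift e.1 e.2 = y then W' e else U e) (mq f) 1)‖ * Real.exp (-(β *
    wilsonAction (fundamentalRep (Fin 3)) (fun e => if e.1 = x ∨ Site.shift e.1 e.2 = x ∨ e.1 = y ∨ Site.shift e.1
    e.2 = y then W' e else U e))) ∂(Measure.pi fun _ : Edge 4 L => haarProbability SU3) then (1 : ℝ) else 0) *
    Real.exp (-(β * wilsonAction (fundamentalRep (Fin 3)) (fun e => if e.1 = x ∨ Site.shift e.1 e.2 = x ∨ e.1 = y ∨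
    Site.shift e.1 e.2 = y then W e else U e))) ∂(Measure.pi fun _ : Edge 4 L => haarProbability SU3) ≤ C * η ^ c *
    ∫ W', Real.exp (-(β * wilsonAction (fundamentalRep (Fin 3)) (fun e => if e.1 = x ∨ Site.shift e.1 e.2 = x ∨ e.1
    = y ∨ Site.shift e.1 e.2 = y then W' e else U e))) ∂(Measure.pi fun _ : Edge 4 L => haarProbability SU3)) :=
  twoStarFlatnessPackage

end Summit.QuantumFields.QCD.Cruxes.PhaseQuenchedFlavourDecay.CrossingSplitIntegrability

end
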